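import Summits.CriticalPhenomena.CardyFormulaZ2.Theorems.CardyMagicRigidityPinchResamplingDefsV3
import Summits.CriticalPhenomena.CardyFormulaZ2.Theorems.CardySelfRefinementLagHandOffSixArmOfFiveArm
import Literature.Probability.Percolation.BondPercolationSymmetry
import HarnessLib

/-!
# Stub S6 `stub_fiveArmUpperZ2` of line `pinch-resampling` v3 (crux `NestingRigidity`, stmt-CriticalPhenomena-4835):
# the `ℤ²` six-arm bound the transfer consumes, from `FiveArmUpperZ2`

Helper module (proofs only; no `def`, no named fact).  The neck-tomography transfer `stub_neckTomography` (S10) uses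
`FiveArmUpperZ2` only through the good events G1/G2 on `ℤ²`, i.e. through an alternating SIX-arm bound with exponent
`2 + ε`: "no neck region crossed by three macroscopic strands" = six interface crossings of an annulus = three open
crossings of `c + A_{m,n}` lying in pairwise distinct open clusters of the annulus (skeleton docstring of
`FiveArmUpperZ2`: "a six-arm cluster event (three pairwise distinct open crossing clusters) is contained in
`zdFiveArmClusters m n □ (a closed dual crossing)` … so Reimer `reimer_holds` and the dual one-arm bound give exponent
`2 + α`").  Exactly this Reimer/RSW step is ALREADY LANDED in the tree, for the sibling crux `LagHandOff`
(line `hitting-tournament`, K3 reduction `stub_sixArm_of_fiveArm`, p147306, file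
`Theorems/CardySelfRefinementLagHandOffSixArmOfFiveArm.lean`), in the cluster form
`FarField.sixArmThreeClustersAt c m n` (`Theorems/CardySelfRefinementDefs.lean`: three open crossings of
`c + A_{m,n}` pairwise NOT joined by an open path of `c + A_{m,n}`) and from the five-arm upper bound in the
recentred form `P_{1/2}(ω - c ∈ zdFiveArmClusters m n) ≤ C₅ (m/n)²`.  This file is the two-line bridge, the `ℤ²`
twin of `sixArm_le_of_fiveArmUpperT` (`…PinchResamplingDefsV3.lean`):

* `fiveArmUpperZ2_shift` — `FiveArmUpperZ2` in the recentred form, uniformly in the centre (translation invariance,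
  `bondPercolation_real_preimage_shift`);
* `sixArmZ2_le_of_fiveArmUpperZ2` (registered anchor) — **`FiveArmUpperZ2 ⇒ P_{1/2}(sixArmThreeClustersAt c m n) ≤
  C (m/n)^{2+ε}` for some `ε > 0`, all centres `c` and all `1 ≤ m ≤ n`**;
* `sixArmZ2_le_of_fiveArmUpperZ2'` — the same with the monomial split `(m/n)² · (m/n)^ε` used by
  `sixArm_le_of_fiveArmUpperT`.

References: D. Reimer, Combin. Probab. Comput. 9 (2000); P. Nolin, EJP 13 (2008), proof of Cor. 36; H. Duminil-Copin,
I. Manolescu, V. Tassion, PTRF 181 (2021), Cor. 6.7 ("Conditionally on the first five arms, the probability that an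
additional dual arm exists decays at least as fast as `(r/R)^c`").
-/

noncomputable section

namespace Summit.CriticalPhenomena.CardyFormulaZ2.Cruxes.NestingRigidity.PinchResampling

open MeasureTheory Literature.Probability.Percolation Literature.Probability.LatticeModels
open Summit.CriticalPhenomena.CardyFormulaZ2.Theorems.CardySelfRefinement.FarField
open Summit.CriticalPhenomena.CardyFormulaZ2.Cruxes.LagHandOff.HittingTournament

/-- **`FiveArmUpperZ2` recentred**: by translation invariance of `P_{1/2}` (`bondPercolation_real_preimage_shift`)
the bound `P_{1/2}(ω - c ∈ 𝒜₅(A_{m,n})) ≤ C (m/n)²` holds uniformly in the centre `c` — the hypothesis `h₅` of the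
tree's `stub_sixArm_of_fiveArm` and (S5) of `sixArmDecayAlong_of_fiveArm`. -/
theorem fiveArmUpperZ2_shift (h : FiveArmUpperZ2) :
    ∃ C₅ : ℝ, ∃ m₀ : ℕ, ∀ (c : Site 2) (m n : ℕ), m₀ ≤ m → m ≤ n →
      (bondPercolation (zdGraph 2) half).real
        (BondConfig.relabel (sym2Equiv (Site.shift (-c))) ⁻¹' zdFiveArmClusters m n) ≤ C₅ * ((m : ℝ) / n) ^ 2 := by
  obtain ⟨C, m₀, h⟩ := h
  refine ⟨C, m₀, fun c m n hm hmn ↦ ?_⟩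
  rw [bondPercolation_real_preimage_shift]
  exact h m n hm hmn

/-- **Six alternating arms on `ℤ²` decay with exponent `2 + ε`, given `FiveArmUpperZ2`** (registered anchor): for
some `ε > 0` and `C`, `P_{1/2}(sixArmThreeClustersAt c m n) ≤ C (m/n)^{2+ε}` for every centre `c` and all `1 ≤ m ≤ n`
— the landed K3 reduction `stub_sixArm_of_fiveArm` (Reimer with a disjoint sixth dual witness + RSW decay over
geometric annuli) applied to `fiveArmUpperZ2_shift`. -/
theorem sixArmZ2_le_of_fiveArmUpperZ2 : FiveArmUpperZ2 → ∃ ε : ℝ, 0 < ε ∧ ∃ C : ℝ, ∀ (c : Site 2) (m n : ℕ), 1 ≤ m → m ≤ n → (bondPercolation (zdGraph 2) half).real (Summit.CriticalPhenomena.CardyFormulaZ2.Theorems.CardySelfRefinement.FarField.sixArmThreeClustersAt c m n) ≤ C * ((m : ℝ) / n) ^ (2 + ε) :=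
  fun h ↦ stub_sixArm_of_fiveArm (fiveArmUpperZ2_shift h)

/-- The same six-arm bound with the monomial split `C · ((m/n)² · (m/n)^ε)` (real powers), the shape of
`sixArm_le_of_fiveArmUpperT`. -/
theorem sixArmZ2_le_of_fiveArmUpperZ2' (h : FiveArmUpperZ2) :
    ∃ C ε : ℝ, 0 < ε ∧ ∀ (c : Site 2) (m n : ℕ), 1 ≤ m → m ≤ n →
      (bondPercolation (zdGraph 2) half).real (sixArmThreeClustersAt c m n) ≤
        C * (((m : ℝ) / n) ^ (2 : ℝ) * ((m : ℝ) / n) ^ ε) := by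
  obtain ⟨ε, hε, C, h⟩ := sixArmZ2_le_of_fiveArmUpperZ2 h
  refine ⟨C, ε, hε, fun c m n hm hmn ↦ ?_⟩
  have hq : 0 < (m : ℝ) / n := div_pos (by exact_mod_cast hm) (by exact_mod_cast (hm.trans hmn))
  rw [← Real.rpow_add hq]
  exact h c m n hm hmn

end Summit.CriticalPhenomena.CardyFormulaZ2.Cruxes.NestingRigidity.PinchResampling

end
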